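import Summits.Ventures.PercRepro.C025ProfileThinTriangleA

/-!
# THE ROW `(q, q+1)` ON THIN MATROIDS WITH A `g`-CIRCUIT — part A: STRUCTURE (night-3 g15)
The `g`-circuit generalisation of `C025ProfileThinTriangleA`: a finite matroid of girth `≥ g` (`hgirth`: every set of `≤ g − 1` points has
full rank) with a `g`-circuit `C₀` (`C₀ ⊆ E`, `|C₀| = g`, `ρ(C₀) = g − 1`, `g ≥ 3`) in which every rank-`q` set has at most `q + 1` points
(THIN). The generic structure (submodularity, the discrete intermediate-value lemma with monotone nullity, the unique inner point, the
σ-loader injection) is imported from part A of the triangle chain; this file generalises the `K`-specific lemmas from `|K| = 3` to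
`|C₀| = g`: `rkN_add_one_le_card_of_subset` (a set containing `C₀` has nullity `≥ 1`), `subset_iff_card_inter_eq` (`C₀ ⊆ B ↔ |B ∩ C₀| = g`),
`crk_add_card_add_one_le` (`C₀ ⊆ E ∖ B` ⇒ `ρ(E ∖ B) ≤ |E ∖ B| − 1`), `rkN_insert_eq_of_top` (the missing point of `C₀` is the inner point
of a `q`-set with `g − 1` points of `C₀`), `rkN_erase_eq_succ_of_mem` / `rkN_erase_eq_of_notMem` (the shape `C₀ ⊆ S`), `rkN_sdiff_add_card_le`
(removing `d` coloops lowers the rank by `d`) and **`card_col_le`**: a `(q+2)`-set of rank `q + 1` not containing `C₀` has at most `g − 1`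
coloops (`g` coloops would give `T = S ∖ D` of rank `≤ q + 1 − g` with `q + 2 − g` points, and `T ∪ C₀` of nullity `≥ 2` and rank `≤ q` below
`S ∪ C₀`). No `def`, no `instance`, no notation.
-/
open scoped Matroid
namespace PercRepro
open Set Finset ThmH Staged
namespace ThinGirth
variable {α : Type} [DecidableEq α] {M : Matroid α} [M.Finite]

/-- A set containing the `g`-circuit `C₀` has rank at most `|X| − 1`. -/
theorem rkN_add_one_le_card_of_subset {g : ℕ} {C₀ X : Finset α} (hCc : C₀.card = g) (hCrk : rkN M C₀ + 1 = g)
    (hCX : C₀ ⊆ X) : rkN M X + 1 ≤ X.card := by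
  have h1 : C₀ ∪ (X \ C₀) = X := Finset.union_sdiff_of_subset hCX
  have h2 : rkN M X ≤ rkN M C₀ + rkN M (X \ C₀) := by
    calc rkN M X = rkN M (C₀ ∪ (X \ C₀)) := by rw [h1]
      _ ≤ rkN M C₀ + rkN M (X \ C₀) := OneCircuit.rkN_union_le_add C₀ (X \ C₀)
  have h3 : rkN M (X \ C₀) ≤ (X \ C₀).card := rkN_le_card _
  have h4 : (X \ C₀).card = X.card - C₀.card := Finset.card_sdiff_of_subset hCX
  have h5 : C₀.card ≤ X.card := Finset.card_le_card hCX
  omega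

/-- `C₀ ⊆ B` iff `|B ∩ C₀| = g` (for `|C₀| = g`). -/
theorem subset_iff_card_inter_eq {g : ℕ} {C₀ B : Finset α} (hCc : C₀.card = g) : C₀ ⊆ B ↔ (B ∩ C₀).card = g := by
  constructor
  · intro h; rw [Finset.inter_eq_right.mpr h]; exact hCc
  · intro h
    have hsub : B ∩ C₀ ⊆ C₀ := Finset.inter_subset_right
    have heq : B ∩ C₀ = C₀ := Finset.eq_of_subset_of_card_le hsub (by omega)
    intro k hk; rw [← heq] at hk; exact (Finset.mem_inter.mp hk).1

/-- `ρ(E ∖ B) + |B| + 1 ≤ |E|` when `B` misses the circuit `C₀`. -/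
theorem crk_add_card_add_one_le {g : ℕ} {C₀ B : Finset α} (hCc : C₀.card = g) (hCrk : rkN M C₀ + 1 = g)
    (hCg : C₀ ⊆ gr M) (hBg : B ⊆ gr M) (hdisj : (B ∩ C₀).card = 0) : crk M B + B.card + 1 ≤ (gr M).card := by
  have hCsub : C₀ ⊆ gr M \ B := by
    intro k hk
    rw [Finset.mem_sdiff]
    refine ⟨hCg hk, fun hkB => ?_⟩
    have : k ∈ B ∩ C₀ := Finset.mem_inter.mpr ⟨hkB, hk⟩
    rw [Finset.card_eq_zero] at hdisj
    rw [hdisj] at this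
    exact Finset.notMem_empty _ this
  have h1 : crk M B + 1 ≤ (gr M \ B).card := rkN_add_one_le_card_of_subset hCc hCrk hCsub
  have h2 : (gr M \ B).card = (gr M).card - B.card := Finset.card_sdiff_of_subset hBg
  have h3 : B.card ≤ (gr M).card := Finset.card_le_card hBg
  omega

/-- **The missing point of `C₀` is the inner point of a top-type set**: `|B| = q`, `ρ(B) = q`, `|B ∩ C₀| + 1 = g`, `k ∈ C₀ ∖ B` ⇒
`ρ(B ∪ {k}) = q`. -/
theorem rkN_insert_eq_of_top {q g : ℕ} {C₀ B : Finset α} (hCc : C₀.card = g) (hCrk : rkN M C₀ + 1 = g)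
    (hBc : B.card = q) (hB : rkN M B = q) (hBC : (B ∩ C₀).card + 1 = g) {k : α} (hkC : k ∈ C₀) (hkB : k ∉ B) :
    rkN M (insert k B) = q := by
  have hCB : (C₀ \ B).card = 1 := by have := OneCircuit.card_sdiff_add_card_inter' C₀ B; omega
  have hCsub : C₀ ⊆ insert k B := by
    intro z hz
    by_cases hzB : z ∈ B
    · exact Finset.mem_insert_of_mem hzB
    · have hzCB : z ∈ C₀ \ B := Finset.mem_sdiff.mpr ⟨hz, hzB⟩
      have hkCB : k ∈ C₀ \ B := Finset.mem_sdiff.mpr ⟨hkC, hkB⟩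
      obtain ⟨a, ha⟩ := Finset.card_eq_one.mp hCB
      rw [ha, Finset.mem_singleton] at hzCB hkCB
      rw [hzCB, ← hkCB]
      exact Finset.mem_insert_self k B
  have hEq : insert k B = (B \ C₀) ∪ C₀ := by
    ext z
    simp only [Finset.mem_insert, Finset.mem_union, Finset.mem_sdiff]
    constructor
    · rintro (rfl | hzB)
      · right; exact hkC
      · by_cases hzC : z ∈ C₀
        · right; exact hzC
        · left; exact ⟨hzB, hzC⟩
    · rintro (⟨hzB, _⟩ | hzC)
      · right; exact hzB
      · exact Finset.mem_insert.mp (hCsub hzC)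
  have h1 : rkN M ((B \ C₀) ∪ C₀) ≤ rkN M (B \ C₀) + rkN M C₀ := OneCircuit.rkN_union_le_add _ _
  have h2 : rkN M (B \ C₀) ≤ (B \ C₀).card := rkN_le_card _
  have h3 : (B \ C₀).card + (B ∩ C₀).card = B.card := Finset.card_sdiff_add_card_inter B C₀
  have h4 : rkN M B ≤ rkN M (insert k B) := rkN_mono (Finset.subset_insert k B)
  rw [hEq] at h4 ⊢
  omega

/-- **Shape `C₀ ⊆ S`, a point of `C₀`**: for `ρ(S) = q + 1` and `c ∈ C₀`, `ρ(S ∖ {c}) = q + 1` (girth: `C₀ ∖ {c}` is independent). -/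
theorem rkN_erase_eq_succ_of_mem {q g : ℕ} (hgirth : ∀ X ⊆ gr M, X.card + 1 ≤ g → rkN M X = X.card)
    {C₀ S : Finset α} (hCg : C₀ ⊆ gr M) (hCc : C₀.card = g) (hCrk : rkN M C₀ + 1 = g) (hCS : C₀ ⊆ S)
    (hS : rkN M S = q + 1) {c : α} (hcC : c ∈ C₀) : rkN M (S.erase c) = q + 1 := by
  have hsub := ThinTriangle.rkN_inter_add_union_le (M := M) (S.erase c) C₀
  have hinter : S.erase c ∩ C₀ = C₀.erase c := by
    ext z
    simp only [Finset.mem_inter, Finset.mem_erase]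
    constructor
    · rintro ⟨⟨h1, _⟩, h3⟩; exact ⟨h1, h3⟩
    · rintro ⟨h1, h2⟩; exact ⟨⟨h1, hCS h2⟩, h2⟩
  have hunion : S.erase c ∪ C₀ = S := by
    ext z
    simp only [Finset.mem_union, Finset.mem_erase]
    constructor
    · rintro (⟨_, h⟩ | h)
      · exact h
      · exact hCS h
    · intro h
      by_cases hzc : z = c
      · right; rw [hzc]; exact hcC
      · left; exact ⟨hzc, h⟩
  have hce := Finset.card_erase_of_mem hcC
  have hCc' : rkN M (C₀.erase c) + 1 = g := by
    rw [hgirth (C₀.erase c) ((Finset.erase_subset c C₀).trans hCg) (by omega)]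
    omega
  rw [hinter, hunion, hS] at hsub
  have h2 : rkN M (S.erase c) ≤ rkN M S := rkN_mono (Finset.erase_subset c S)
  omega

/-- **Shape `C₀ ⊆ S`, a point outside `C₀`**: for `|S| = q + 2`, `ρ(S) = q + 1`, `c ∈ S ∖ C₀`, `ρ(S ∖ {c}) = q`. -/
theorem rkN_erase_eq_of_notMem {q g : ℕ} {C₀ S : Finset α} (hCc : C₀.card = g) (hCrk : rkN M C₀ + 1 = g) (hCS : C₀ ⊆ S)
    (hSc : S.card = q + 2) (hS : rkN M S = q + 1) {c : α} (hcS : c ∈ S) (hcC : c ∉ C₀) : rkN M (S.erase c) = q := by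
  have hCsub : C₀ ⊆ S.erase c := fun z hz => Finset.mem_erase.mpr ⟨fun h => hcC (h ▸ hz), hCS hz⟩
  have h1 := rkN_add_one_le_card_of_subset hCc hCrk hCsub
  have h2 := Finset.card_erase_of_mem hcS
  have h3 : rkN M S ≤ rkN M (S.erase c) + 1 := by
    have := rkN_insert_le (M := M) (X := S.erase c) c
    rw [Finset.insert_erase hcS] at this
    exact this
  omega

/-- **Removing coloops**: for `D ⊆ S` consisting of coloops of `S` (`ρ(S ∖ {c}) + 1 = ρ(S)`), `ρ(S ∖ D) + |D| ≤ ρ(S)`. -/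
theorem rkN_sdiff_add_card_le {S : Finset α} (D : Finset α) (hDS : D ⊆ S)
    (hD : ∀ c ∈ D, rkN M (S.erase c) + 1 = rkN M S) : rkN M (S \ D) + D.card ≤ rkN M S := by
  induction D using Finset.induction_on with
  | empty => simp
  | insert c D hcD ih =>
    have hDS' : D ⊆ S := (Finset.subset_insert c D).trans hDS
    have hD' : ∀ c ∈ D, rkN M (S.erase c) + 1 = rkN M S := fun c hc => hD c (Finset.mem_insert_of_mem hc)
    have ih' := ih hDS' hD'
    have hcS : c ∈ S := hDS (Finset.mem_insert_self c D)
    have hc := hD c (Finset.mem_insert_self c D)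
    have hsub := ThinTriangle.rkN_inter_add_union_le (M := M) (S \ D) (S.erase c)
    have hi : S \ D ∩ S.erase c = S \ insert c D := by
      ext z
      simp only [Finset.mem_inter, Finset.mem_sdiff, Finset.mem_erase, Finset.mem_insert, not_or]
      tauto
    have hu : S \ D ∪ S.erase c = S := by
      ext z
      simp only [Finset.mem_union, Finset.mem_sdiff, Finset.mem_erase]
      constructor
      · rintro (⟨h, _⟩ | ⟨_, h⟩) <;> exact h
      · intro h
        by_cases hzc : z = c
        · left; exact ⟨h, by rw [hzc]; exact hcD⟩
        · right; exact ⟨hzc, h⟩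
    rw [hi, hu] at hsub
    rw [Finset.card_insert_of_notMem hcD]
    omega

/-- **Shape `C₀ ⊄ S`: at most `g − 1` coloops.** A `(q+2)`-set `S` of rank `q + 1` not containing `C₀` has at most `g − 1` points `c`
with `ρ(S ∖ {c}) = q`: `g` of them would give `T = S ∖ D` of rank `≤ q + 1 − g` with `q + 2 − g` points, and `T ∪ C₀` (nullity `≥ 2`,
rank `≤ q`) sits below `S ∪ C₀` (rank `≥ q + 1`), against `card_le_rkN_add_one_of_between`. -/
theorem card_col_le {q g : ℕ} (hgirth : ∀ X ⊆ gr M, X.card + 1 ≤ g → rkN M X = X.card)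
    (hthin : ∀ X ⊆ gr M, rkN M X = q → X.card ≤ q + 1)
    {C₀ S : Finset α} (hCg : C₀ ⊆ gr M) (hCc : C₀.card = g) (hCrk : rkN M C₀ + 1 = g) (hSg : S ⊆ gr M)
    (hSc : S.card = q + 2) (hS : rkN M S = q + 1) (hCS : ¬ C₀ ⊆ S) :
    (S.filter (fun c => rkN M (S.erase c) = q)).card + 1 ≤ g := by
  by_contra hcon
  push Not at hcon
  obtain ⟨D, hDsub, hDc⟩ := Finset.exists_subset_card_eq
    (show g ≤ (S.filter (fun c => rkN M (S.erase c) = q)).card by omega)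
  have hDS : D ⊆ S := hDsub.trans (Finset.filter_subset _ _)
  have hD : ∀ c ∈ D, rkN M (S.erase c) + 1 = rkN M S := by
    intro c hc
    have := (Finset.mem_filter.mp (hDsub hc)).2
    omega
  have hTr := rkN_sdiff_add_card_le D hDS hD
  have hTc : (S \ D).card + D.card = S.card := by
    rw [Finset.card_sdiff_of_subset hDS]
    have := Finset.card_le_card hDS
    omega
  -- `T ∩ C₀` is a proper subset of `C₀`, hence independent
  have hSC : (S ∩ C₀).card + 1 ≤ g := by
    have h3 : (S ∩ C₀).card ≤ g := (Finset.card_le_card Finset.inter_subset_right).trans hCc.le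
    have h4 : (S ∩ C₀).card ≠ g := fun h => hCS ((subset_iff_card_inter_eq hCc).mpr h)
    omega
  have hTC : ((S \ D) ∩ C₀).card + 1 ≤ g := by
    have := Finset.card_le_card (Finset.inter_subset_inter (Finset.sdiff_subset (s := S) (t := D))
      (Finset.Subset.refl C₀))
    omega
  have hTCr : rkN M ((S \ D) ∩ C₀) = ((S \ D) ∩ C₀).card :=
    hgirth _ (Finset.inter_subset_right.trans hCg) hTC
  have hsub := ThinTriangle.rkN_inter_add_union_le (M := M) (S \ D) C₀
  rw [hTCr] at hsub
  have hXc := Finset.card_union_add_card_inter (S \ D) C₀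
  have hXq : rkN M ((S \ D) ∪ C₀) ≤ q := by omega
  have hYr : q ≤ rkN M (S ∪ C₀) := by
    have := rkN_mono (M := M) (Finset.subset_union_left (s₁ := S) (s₂ := C₀))
    omega
  have hXY : (S \ D) ∪ C₀ ⊆ S ∪ C₀ := Finset.union_subset_union Finset.sdiff_subset (Finset.Subset.refl C₀)
  have := ThinTriangle.card_le_rkN_add_one_of_between hthin hXY (Finset.union_subset hSg hCg) hXq hYr
  omega

end ThinGirth
end PercRepro
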